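import Summits.QuantumFields.YangMills.Theorems.BalabanUVNodesK0AxTransverseWardRoad
import Summits.QuantumFields.YangMills.Theorems.BalabanUVNodesPortHDecayOfRowsTrace
import Summits.QuantumFields.YangMills.Theorems.BalabanUVNodesPortHRecordJoinSwap
import Summits.QuantumFields.YangMills.Theorems.BalabanUVNodesPortHRecordJoinRows

/-!
# K0ᴬ TRANSVERSE WARD READ-OUT — PART 3: THE TRACE-FORM ROAD ON TRANSVERSE LEGS, AND THE ROAD AT THE RECORD'S CHART DATA WITH `hfl`∕`hEq`∕`hN`∕`ChartSymm` DISCHARGED BY NAME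

◇ LENS-1 `ymgap-nodeO-lens-1` g7 (lens-1 := «cauchy-analytic», director R582), HOME `pub/ym-nodeO-ideate/nodeO-cover/LENS-1-RoadTraceAtRecord-v1.lean`.  Count-neutral; proposed for
landing by porter PTB-1 (`--supports stmt-QuantumFields-27238 --as helper`), split at the lander's discretion into
(R) `…/Theorems/BalabanUVNodesK0AxGaugeFlowRec.lean` (= PART B below = `LENS-1-GaugeFlowRec-v1.1.lean` 893d0a25a0ac40cf VERBATIM) and
(T3) `…/Theorems/BalabanUVNodesK0AxTransverseWardRoadTrace.lean` (PART A + PART C).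

WHY THIS FILE.  The record JOIN of the K0ᴬ lineage (✓ `…PortHRecordJoin` §15) consumes the TRACE road ✓p801140 `PortH.decay510_plimOf_of_rows_trace` (W2: colour-indexed responses `Gc n a`,
per-colour gauge decay, no colour-scalar row), whereas NODE v8 (A) = ✓p813014 `Road.decay510_plimOf_of_rows_transverse(Symm)` re-ran the a★-road `PortH.decay510_plimOf_of_rows`.  PART A is the
missing drop-in: the TRACE road re-run on transverse legs, `Ad`-sharpened —
* ★ `Road.polComp_diag_eq_sum_re_mixedDeriv_transverseSymm` — (4.37) per volume AND PER COLOUR on RowLᵀ♯ legs: `Π^{aa}_{01}(z,0) = Σ_X Re ∂²(𝐄ₙ(X)∘χ_X)[cut Gc n a (e 1 0), cut Gc n a (e 0 z)]`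
  when the honest legs `Dιₙ(0)(δ_{μz}·bV a)` and the tabulated legs `Gc n a (e μ z)` differ by a pure-gauge leg and ONE chart symmetry `T = T(n, a)`;
* ★ `Road.abs_polComp_diag_le_of_rows_transverseSymm` — the per-colour (5.10) core at one volume on transverse legs;
* ★★★ `Road.decay510_plimOf_of_rows_trace_transverseSymm` — THE TRACE ROAD ON TRANSVERSE LEGS: binder list of `PortH.decay510_plimOf_of_rows_trace` BYTE-IDENTICAL except + `{P}`∕`gradLeg`,
  + `(hfl : ChartGaugeFlow act coords χ gradLeg)`, and the colour-indexed RowL «`Gc n a (e μ z) = Dιₙ(0)(δ_{μz}·bV a)`» ↦ RowLᵀ♯ «`∀ a, ∃ T, ChartSymm act χ n T ∧ ∀ μ z, ∃ p, Dιₙ(0)(δ_{μz}·bV a) − T (Gc n a (e μ z))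
  = gradLeg n p`»; SAME conclusion `Decay510 (plimOf … 0 1) (16·E₀·C₉²·e^{δ₁Mg c₁}·K₀·K₁) δ₁`; + the compatibility certificate `Road.decay510_plimOf_of_rows_trace_of_transverseSymm` (the tree's
  trace road is the special case `gradLeg := 0`, `T := 1`; no junk inhabitant).
PART B = leaf (B) (`K0AxGaugeFlowRec`, ★★★ `chartGaugeFlow_record`).  PART C = THE ROAD AT THE RECORD'S CHART DATA: ★ `chartSymm_recordAdJ` (every constant `h ∈ SU(2)` is a chart symmetry,
▶ PTA-2's ✓ `chartEquivariantAtJ` through (L)) and ★★★ `decay510_plimOf_of_rows_trace_transverse_record` — PART A's road with `S, M, m, Gg, P, act, coords, χ, toG, A, gradLeg` :=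
the record's `recordDomSys ∕ recordBondCount ∕ recordChartDimJ ∕ recordGaugeGrp ∕ (sites → ℂ³) ∕ recordAct ∕ recordCoords ∕ recordChartJ ∕ recordToG ∕ recordAdJ ∕ recordGradLeg` along ANY member
map `K : ℕ → ℕ`, and the four structural binders `hEq` (✓ `chartEquivariantAtJ`), `hN` (✓ `noInvariantCovectorAtJ`), `hfl` (✓ `chartGaugeFlow_record`, PART B) and the `ChartSymm` conjunct of RowLᵀ♯
(✓ `chartSymm_recordAdJ`) DISCHARGED BY NAME — what remains displayed is exactly: FORMAT⁺ᴳ, `Chart44D`, the (A3) cut, per-colour gauge decay of the cut tabulated legs, the three leaves, the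
window isometry, (1.21), and RowLᵀ♯ at the record «`∀ a, ∃ h : SU 2, ∀ μ z, ∃ φ, Dιₙ(0)(δ_{μz}·bV a) − Ad_h (Gc n a (e μ z)) = recordGradLeg φ`» (= receipt (C)♯ `K0AxRowLTRec.ResponseRowAtLTSymm`
read at the JOIN's leg labels).  KERNEL CERTIFICATE: the binder types of leaf (B) and of the ♯-conjunct UNIFY with the road's at the record (this file elaborates).
[I] = [Balaban1987RG1], [15] = [Balaban1985Variational], [B6] = [Balaban1984PropagatorsII].

LANDING NOTE (porter `ymgap-nodeO-port-PTB-1` g4, 2026-08-31): landed under ◆ CRIT-1 g35 CUT №3 (PASS ×3) as TWO files: THIS file = PART A (generic trace road,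
namespace `…Theorems.K0AxTransverseWard`); `…/Theorems/BalabanUVNodesK0AxTransverseWardRoadTraceRecord.lean` = PART C (the road at the record's chart data, namespace
`…Theorems.K0AxGaugeFlowRec`); PART B dropped (= ✓p813155∕✓p813470 `…K0AxGaugeFlowRec[Defs]`, imported there).  Decl names∕statements verbatim.
`--supports stmt-QuantumFields-27238 --as helper`.

HONEST FRAMING.  Generic implications over DISPLAYED rows + finite-dimensional matrix calculus at the record; NOTHING of Bałaban ([I] Thm 1, (1.19)–(1.22), (4.8), (4.14)–(4.15), (4.35)–(4.37),
(5.10); [15] Thm 1, Prop. 9, (174)–(177), (190); [B6] (2.35), Prop. 2.5 AT THE RECORD) is asserted, ported or discharged; (C)♯∕(C-tab) OPEN · M modulo P0; typed ≠ proved; K0ᴬ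
`Record13SepCoPHInhabitedAx` (stmt-QuantumFields-27238) OPEN 1∕2; NODE O 0∕1; COUNT 8∕28 · K 1∕4 UNMOVED; ONE finite `𝕋⁴_{L^K}` at fixed ε — NOT continuum ∕ OS ∕ Clay; **the Yang–Mills mass gap
(Clay) is NOT proved by any of this.**  No `sorry`, no `instance`, no `notation`; standard axioms only.
-/


noncomputable section

/-! # PART A — THE TRACE-FORM ROAD ON TRANSVERSE LEGS (generic; drop-in variant of ✓p801140 `PortH.decay510_plimOf_of_rows_trace`) -/

namespace Summit.QuantumFields.YangMills.Theorems.K0AxTransverseWard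

open scoped BigOperators Topology
open Set Filter Metric

open Literature.MathematicalPhysics.QuantumFieldTheory.Balaban1983to89.B12ChartGaugeFlow48
open Literature.MathematicalPhysics.QuantumFieldTheory.Balaban1983to89
open Literature.MathematicalPhysics.QuantumFieldTheory.Balaban1983to89.B12Decay510 (SiteGeometry KernelBound GeomLeaf CubeSumLeaf TreeLeaf delta1 mixedDeriv
  abs_twoPoint_le_delta1)
open Literature.MathematicalPhysics.QuantumFieldTheory.Balaban1983to89.B12FormatPlus

namespace Road

open Literature.MathematicalPhysics.QuantumFieldTheory.Balaban1983to89.Node00 (TermFamily1 siteOfInt)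
open Literature.MathematicalPhysics.QuantumFieldTheory.Balaban1983to89.T4Continuum (T4Family)
open Literature.MathematicalPhysics.QuantumFieldTheory.Balaban1983to89.B12Decay510 (decay510_of_tendsto)
open Literature.MathematicalPhysics.QuantumFieldTheory.Balaban1983to89.B12Eq435SecondVariation (ofReal_fderiv_fderiv_eq_sum_mixedDeriv_of_repr)
open Literature.MathematicalPhysics.QuantumFieldTheory.Balaban1983to89.Beta.RemainderLocality (mixedDeriv_comp_clm)
open Summit.QuantumFields.YangMills.Theorems.K0RecordFormatNames (ΦfOf pvolOf plimOf)
open Summit.QuantumFields.YangMills.Theorems.BalabanUVNodesPortS1 (ward414_of_gaugeInv119_chart44D)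
open Summit.QuantumFields.YangMills.Theorems.PortH (exists_cutTo_clm pvolOf_eq_trace)

variable (F : T4Family) {𝔄 : Type} [NormedRing 𝔄] [NormedAlgebra ℝ 𝔄] {V : Type} [NormedAddCommGroup V] [NormedSpace ℝ V] {ι : Type} [Fintype ι]
  (fam : TermFamily1 F 𝔄) (ρ : V →L[ℝ] 𝔄) (bV : Module.Basis ι ℝ V) (k : ℕ) (v : Fin (k + 1) → ℝ)
  {S : ℕ → LocDomainSys} {M m : ℕ → ℕ}

omit [Fintype ι] in
/-- ★ **(4.37) PER VOLUME AND PER COLOUR — TRANSVERSE LEGS, `Ad`-SHARPENED**: as `PortH.polComp_diag_eq_sum_re_mixedDeriv`, with the colour-indexed response link replaced by RowLᵀ♯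
«for each colour `a`, the honest legs `Dιₙ(0)(δ_{μz}·bV a)` and the tabulated legs `Gc n a (e μ z)` differ by a pure-gauge leg and one chart symmetry `T`» + (1.19) for the pieces + the
chart-level gauge flow: `Π^{aa}_{01}(z, 0) = Σ_X Re ∂²(𝐄ₙ(X)∘χ_X)[cut Gc n a (e 1 0), cut Gc n a (e 0 z)]` on the CUT TABULATED legs.
[cite: Balaban1987RG1, (4.35) p.290, (4.37) p.291, (4.15) p.284, (4.8) p.283, (1.19)–(1.20) pp.263–264, (1.7) p.261] -/
theorem polComp_diag_eq_sum_re_mixedDeriv_transverseSymm (Uc : (n : ℕ) → (S n).Dom → Set (Fin (M n) → ℂ)) (coords : (n : ℕ) → (S n).Dom → Finset (Fin (M n)))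
    (χ : (n : ℕ) → (S n).Dom → (Fin (m n) → ℂ) → (Fin (M n) → ℂ)) (D : (n : ℕ) → (S n).Dom → Set (Fin (m n) → ℂ))
    {Gg P : ℕ → Type*} (act : (n : ℕ) → Gg n → (Fin (M n) → ℂ) → (Fin (M n) → ℂ)) (gradLeg : (n : ℕ) → P n → (Fin (m n) → ℂ))
    (E : Pieces S M) (R : Response9Data S M m 4) (K : ℕ → ℕ) (Gc : (n : ℕ) → ι → R.Λ n → (Fin (m n) → ℂ))
    (ιe : (n : ℕ) → (Fin (F.P (K n)).d → Site (F.P (K n)) (k + 1) → V) → (Fin (m n) → ℂ))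
    (hAn : Analytic19 Uc E) (hLoc : Local17 coords E) (hRep : Repr17 S E χ (fun n => ΦfOf F fam ρ k v (K n)) ιe) (hW : Ward414 χ E)
    (hGI : GaugeInv119 act Uc E) (hfl : ChartGaugeFlow act coords χ gradLeg)
    (hC : Chart44D S M Uc m χ D) (hcut : ∀ n X u, ∀ i ∈ coords n X, χ n X (cutTo (R.cX n X) u) i = χ n X u i)
    (hL : ∀ n, ιe n 0 = 0 ∧ ContDiffAt ℝ 2 (ιe n) 0 ∧ ∀ a : ι, ∃ T : (Fin (m n) → ℂ) →L[ℂ] (Fin (m n) → ℂ), ChartSymm act χ n T ∧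
      ∀ (μ : Fin 4) (z : Fin 4 → ℤ), ∃ p : P n,
        fderiv ℝ (ιe n) 0 (Pi.single (Fin.cast (F.P_d (K n)).symm μ) (Pi.single (siteOfInt F (K n) (k + 1) z) (bV a))) - T (Gc n a (R.e n μ z)) = gradLeg n p)
    (n : ℕ) (a : ι) (z : Fin 4 → ℤ) :
    B12PolarizationTensor120.polComp ℝ (B12PolarizationTensor120.expChart (fam k v (K n)) ρ) bV (Fin.cast (F.P_d (K n)).symm 0) (siteOfInt F (K n) (k + 1) z) a
        (Fin.cast (F.P_d (K n)).symm 1) (siteOfInt F (K n) (k + 1) 0) a =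
      ∑ X, (mixedDeriv (fun u => E n X (χ n X u)) (cutTo (R.cX n X) (Gc n a (R.e n 1 0))) (cutTo (R.cX n X) (Gc n a (R.e n 0 z)))).re := by
  classical
  obtain ⟨hι0, hιC2, hGk⟩ := hL n
  obtain ⟨T, hT, hGa⟩ := hGk a
  have hF : ∀ X, AnalyticAt ℂ (fun u => E n X (χ n X u)) 0 := fun X =>
    analyticOnNhd_piece_chart hC hAn n X 0 (hC n X).2.2.2.1
  have hrepr : (fun B => ((B12PolarizationTensor120.expChart (fam k v (K n)) ρ B : ℝ) : ℂ)) =ᶠ[𝓝 0]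
      fun B => ∑ X, (fun u => E n X (χ n X u)) (ιe n B) := hRep n
  set p : Fin (F.P (K n)).d → Site (F.P (K n)) (k + 1) → V :=
    Pi.single (Fin.cast (F.P_d (K n)).symm 0) (Pi.single (siteOfInt F (K n) (k + 1) z) (bV a)) with hp
  set q : Fin (F.P (K n)).d → Site (F.P (K n)) (k + 1) → V :=
    Pi.single (Fin.cast (F.P_d (K n)).symm 1) (Pi.single (siteOfInt F (K n) (k + 1) 0) (bV a)) with hq
  have hbridge := (ofReal_fderiv_fderiv_eq_sum_mixedDeriv_of_repr (fun X u => E n X (χ n X u)) (ιe n) _ hrepr hι0 hιC2 hF (hW n) p q).2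
  have hpc : ((B12PolarizationTensor120.polComp ℝ (B12PolarizationTensor120.expChart (fam k v (K n)) ρ) bV (Fin.cast (F.P_d (K n)).symm 0)
      (siteOfInt F (K n) (k + 1) z) a (Fin.cast (F.P_d (K n)).symm 1) (siteOfInt F (K n) (k + 1) 0) a : ℝ) : ℂ) =
      ∑ X, mixedDeriv (fun u => E n X (χ n X u)) (fderiv ℝ (ιe n) 0 q) (fderiv ℝ (ιe n) 0 p) := hbridge
  -- RowLᵀ♯ + W2♭ + the chart symmetry: swap the honest legs for the tabulated (transverse) legs of colour `a`
  have hswap : ∑ X, mixedDeriv (fun u => E n X (χ n X u)) (fderiv ℝ (ιe n) 0 q) (fderiv ℝ (ιe n) 0 p) =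
      ∑ X, mixedDeriv (fun u => E n X (χ n X u)) (Gc n a (R.e n 1 0)) (Gc n a (R.e n 0 z)) :=
    sum_mixedDeriv_congr_of_symmGaugeLegs hGI hLoc hfl hC hAn hW n hT (hGa 1 0) (hGa 0 z)
  rw [hswap] at hpc
  have hcutEq : ∀ X (a' b' : Fin (m n) → ℂ), mixedDeriv (fun u => E n X (χ n X u)) a' b' =
      mixedDeriv (fun u => E n X (χ n X u)) (cutTo (R.cX n X) a') (cutTo (R.cX n X) b') := by
    intro X a' b'
    obtain ⟨T', hT'⟩ := exists_cutTo_clm (R.cX n X)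
    have hfun : (fun u => E n X (χ n X u)) = fun u => (fun u => E n X (χ n X u)) (T' u) := by
      funext u; rw [hT']; exact (hLoc n X _ _ fun i hi => (hcut n X u i hi)).symm
    obtain ⟨r, hr, hball⟩ : ∃ r > 0, ∀ y ∈ Metric.ball (0 : Fin (m n) → ℂ) r, DifferentiableAt ℂ (fun u => E n X (χ n X u)) y := by
      obtain ⟨s, hs, hsub⟩ := Metric.mem_nhds_iff.1 (hF X).eventually_analyticAt
      exact ⟨s, hs, fun y hy => (hsub hy).differentiableAt⟩
    conv_lhs => rw [hfun]
    rw [mixedDeriv_comp_clm hr hball T' a' b', hT', hT']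
  rw [Finset.sum_congr rfl fun X _ => hcutEq X _ _] at hpc
  have := congrArg Complex.re hpc
  rw [Complex.ofReal_re, Complex.re_sum] at this
  exact this

omit [Fintype ι] in
/-- ★ **THE PER-COLOUR (5.10) CORE AT ONE VOLUME — TRANSVERSE LEGS**: as `PortH.abs_polComp_diag_le_of_rows` with RowLᵀ♯ in place of the colour-indexed response link (+ (1.19), + the
chart-level gauge flow): `|Π^{aa}_{01}(z, 0)| ≤ 16·E₀·C₉²·e^{δ₁Mg c₁}·K₀·K₁·e^{−δ₁ρₙ(e 1 0, e 0 z)}` from the gauge decay of the CUT TABULATED legs of colour `a`.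
[cite: Balaban1987RG1, (5.10) p.293, (4.35)–(4.37) pp.290–291, (4.4)–(4.5) pp.281–282, (4.8) p.283, (4.15) p.284; Balaban1985Variational, Prop. 9 p.309] -/
theorem abs_polComp_diag_le_of_rows_transverseSymm (Uc : (n : ℕ) → (S n).Dom → Set (Fin (M n) → ℂ)) (coords : (n : ℕ) → (S n).Dom → Finset (Fin (M n)))
    (χ : (n : ℕ) → (S n).Dom → (Fin (m n) → ℂ) → (Fin (M n) → ℂ)) (D : (n : ℕ) → (S n).Dom → Set (Fin (m n) → ℂ))
    {Gg P : ℕ → Type*} (act : (n : ℕ) → Gg n → (Fin (M n) → ℂ) → (Fin (M n) → ℂ)) (gradLeg : (n : ℕ) → P n → (Fin (m n) → ℂ))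
    (E : Pieces S M) (R : Response9Data S M m 4) (K : ℕ → ℕ) (Gc : (n : ℕ) → ι → R.Λ n → (Fin (m n) → ℂ))
    (ιe : (n : ℕ) → (Fin (F.P (K n)).d → Site (F.P (K n)) (k + 1) → V) → (Fin (m n) → ℂ))
    {E₀ κ C₉ δ₀ Mg c₁ K₀ K₁ : ℝ} (hE₀ : 0 ≤ E₀) (hκ : 0 ≤ κ) (hC₉ : 0 ≤ C₉) (hδ₀ : 0 ≤ δ₀) (hMg : 0 < Mg) (hK₀ : 0 ≤ K₀)
    (hAn : Analytic19 Uc E) (hB : Bound118 S Uc E E₀ κ) (hLoc : Local17 coords E) (hRep : Repr17 S E χ (fun n => ΦfOf F fam ρ k v (K n)) ιe)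
    (hW : Ward414 χ E) (hGI : GaugeInv119 act Uc E) (hfl : ChartGaugeFlow act coords χ gradLeg)
    (hC : Chart44D S M Uc m χ D) (hcut : ∀ n X u, ∀ i ∈ coords n X, χ n X (cutTo (R.cX n X) u) i = χ n X u i)
    (n : ℕ) (a : ι)
    (hdec : ∀ X y, gauge (D n X) (cutTo (R.cX n X) (Gc n a y)) ≤ C₉ * Real.exp (-δ₀ * (R.G n).distD y X))
    (hgeo : GeomLeaf (R.G n) (R.ρ n) Mg c₁) (hcube : CubeSumLeaf (R.G n) (δ₀ / 2) K₁) (htree : TreeLeaf (R.Cc n) (κ / 2) K₀)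
    (hL : ∀ n, ιe n 0 = 0 ∧ ContDiffAt ℝ 2 (ιe n) 0 ∧ ∀ a : ι, ∃ T : (Fin (m n) → ℂ) →L[ℂ] (Fin (m n) → ℂ), ChartSymm act χ n T ∧
      ∀ (μ : Fin 4) (z : Fin 4 → ℤ), ∃ p : P n,
        fderiv ℝ (ιe n) 0 (Pi.single (Fin.cast (F.P_d (K n)).symm μ) (Pi.single (siteOfInt F (K n) (k + 1) z) (bV a))) - T (Gc n a (R.e n μ z)) = gradLeg n p)
    (z : Fin 4 → ℤ) :
    |B12PolarizationTensor120.polComp ℝ (B12PolarizationTensor120.expChart (fam k v (K n)) ρ) bV (Fin.cast (F.P_d (K n)).symm 0)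
        (siteOfInt F (K n) (k + 1) z) a (Fin.cast (F.P_d (K n)).symm 1) (siteOfInt F (K n) (k + 1) 0) a| ≤
      16 * E₀ * C₉ ^ 2 * Real.exp (delta1 δ₀ κ Mg * Mg * c₁) * K₀ * K₁ * Real.exp (-(delta1 δ₀ κ Mg) * R.ρ n (R.e n 1 0) (R.e n 0 z)) := by
  rw [polComp_diag_eq_sum_re_mixedDeriv_transverseSymm F fam ρ bV k v Uc coords χ D act gradLeg E R K Gc ιe hAn hLoc hRep hW hGI hfl hC hcut hL n a z]
  have hD : ∀ X : (S n).Dom, Convex ℝ (D n X) ∧ Balanced ℂ (D n X) ∧ IsOpen (D n X) ∧ (0 : Fin (m n) → ℂ) ∈ D n X := fun X => by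
    obtain ⟨h1, h2, h3, h4, -, -⟩ := hC n X; exact ⟨h1, h2, h3, h4⟩
  have han : ∀ X : (S n).Dom, AnalyticOnNhd ℂ (fun u => E n X (χ n X u)) (D n X) := fun X => analyticOnNhd_piece_chart hC hAn n X
  have h118 : ∀ X : (S n).Dom, ∀ w ∈ D n X, ‖E n X (χ n X w)‖ ≤ E₀ * Real.exp (-κ * (S n).dj X) := fun X w hw => by
    obtain ⟨-, -, -, -, -, hmaps⟩ := hC n X
    exact (bound118_iff Uc E E₀ κ).1 hB n X _ (hmaps hw)
  exact B12Decay510Gauge.abs_twoPoint_le_of_gauge (R.G n) (ρ := R.ρ n) (fun X u => E n X (χ n X u)) (D n) (fun X y => cutTo (R.cX n X) (Gc n a y))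
    (fun X x y => (mixedDeriv (fun u => E n X (χ n X u)) (cutTo (R.cX n X) (Gc n a x)) (cutTo (R.cX n X) (Gc n a y))).re)
    hE₀ hC₉ hK₀ hδ₀ hκ hMg hD han h118 (fun _ _ _ => rfl) (fun X y => hdec X y) hgeo hcube htree _ _

/-- ★★★ **THE TRACE-FORM DECAY ROAD ON TRANSVERSE LEGS, `Ad`-SHARPENED** — `PortH.decay510_plimOf_of_rows_trace` (the road the record JOIN consumes) with its binder list BYTE-IDENTICAL except:
+ `{P}`∕`gradLeg`, + the structural row `(hfl : ChartGaugeFlow act coords χ gradLeg)`, and the colour-indexed RowL replaced by RowLᵀ♯ (per colour: one chart symmetry `T` and pure-gauge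
legs).  (1.19)-mould at one real history ∧ `Chart44D` ∧ equivariance ∧ no invariant covector ∧ gauge flow ∧ (A3) ∧ PER-COLOUR gauge decay of the cut TABULATED legs ∧ leaves ∧ window isometry ∧
RowLᵀ♯ ∧ (1.21) ⟹ `Decay510 (plimOf F fam ρ bV k v 0 1) (16·E₀·C₉²·e^{δ₁Mg c₁}·K₀·K₁) δ₁`.  The engine is blind to pure-gauge legs and to chart symmetries, so the tabulated legs may be
read on any gauge-equivalent (e.g. transverse∕(2.35)) table.
[cite: Balaban1987RG1, (5.10) p.293, (4.35)–(4.37) pp.290–291, (4.8) p.283, (4.14)–(4.15) p.284, (1.18)–(1.21) pp.263–264, (4.4)–(4.5) pp.281–282; Balaban1985Variational, Prop. 9 p.309,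
(176) p.306; Balaban1984PropagatorsII, (2.35) p.228] -/
theorem decay510_plimOf_of_rows_trace_transverseSymm [DecidableEq ι] (Uc : (n : ℕ) → (S n).Dom → Set (Fin (M n) → ℂ))
    (coords : (n : ℕ) → (S n).Dom → Finset (Fin (M n)))
    (χ : (n : ℕ) → (S n).Dom → (Fin (m n) → ℂ) → (Fin (M n) → ℂ)) (D : (n : ℕ) → (S n).Dom → Set (Fin (m n) → ℂ))
    {Gg P : ℕ → Type*} (act : (n : ℕ) → Gg n → (Fin (M n) → ℂ) → (Fin (M n) → ℂ)) {Hg : ℕ → Type*} (toG : (n : ℕ) → Hg n → Gg n)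
    (A : (n : ℕ) → Hg n → ((Fin (m n) → ℂ) →L[ℂ] (Fin (m n) → ℂ))) (gradLeg : (n : ℕ) → P n → (Fin (m n) → ℂ))
    (R : Response9Data S M m 4) (K : ℕ → ℕ) (Gc : (n : ℕ) → ι → R.Λ n → (Fin (m n) → ℂ))
    (ιe : (n : ℕ) → (Fin (F.P (K n)).d → Site (F.P (K n)) (k + 1) → V) → (Fin (m n) → ℂ))
    {E₀ κ C₉ δ₀ Mg c₁ K₀ K₁ : ℝ} (hE₀ : 0 ≤ E₀) (hκ : 0 ≤ κ) (hC₉ : 0 ≤ C₉) (hδ₀ : 0 ≤ δ₀) (hMg : 0 < Mg) (hK₀ : 0 ≤ K₀)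
    (hA : FormatPlusG S M act Uc coords m χ (fun n => ΦfOf F fam ρ k v (K n)) ιe R.wrap R.emb R.πc E₀ κ)
    (hC : Chart44D S M Uc m χ D) (hEq : ChartEquivariant toG act χ A) (hN : ∀ n, NoInvariantCovector (A n))
    (hfl : ChartGaugeFlow act coords χ gradLeg)
    (hcut : ∀ n X u, ∀ i ∈ coords n X, χ n X (cutTo (R.cX n X) u) i = χ n X u i)
    (hdec : ∀ n (a : ι) X y, gauge (D n X) (cutTo (R.cX n X) (Gc n a y)) ≤ C₉ * Real.exp (-δ₀ * (R.G n).distD y X))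
    (hgeo : ∀ n, GeomLeaf (R.G n) (R.ρ n) Mg c₁) (hcube : ∀ n, CubeSumLeaf (R.G n) (δ₀ / 2) K₁) (htree : ∀ n, TreeLeaf (R.Cc n) (κ / 2) K₀)
    (hρ : ∀ (μ ν : Fin 4) (z : Fin 4 → ℤ), ∀ᶠ n in atTop, R.ρ n (R.e n μ 0) (R.e n ν z) = B12Sec2to5.l1 z)
    (hL : ∀ n, ιe n 0 = 0 ∧ ContDiffAt ℝ 2 (ιe n) 0 ∧ ∀ a : ι, ∃ T : (Fin (m n) → ℂ) →L[ℂ] (Fin (m n) → ℂ), ChartSymm act χ n T ∧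
      ∀ (μ : Fin 4) (z : Fin 4 → ℤ), ∃ p : P n,
        fderiv ℝ (ιe n) 0 (Pi.single (Fin.cast (F.P_d (K n)).symm μ) (Pi.single (siteOfInt F (K n) (k + 1) z) (bV a))) - T (Gc n a (R.e n μ z)) = gradLeg n p)
    (hLim : Limit121 (fun n => pvolOf F fam ρ bV k v (K n)) (plimOf F fam ρ bV k v)) :
    B12Sec2to5.Decay510 (plimOf F fam ρ bV k v 0 1) (16 * E₀ * C₉ ^ 2 * Real.exp (delta1 δ₀ κ Mg * Mg * c₁) * K₀ * K₁) (delta1 δ₀ κ Mg) := by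
  obtain ⟨E, hAn, hB, hLoc, hRep, -, hG⟩ := hA
  have hW : Ward414 χ E := ward414_of_gaugeInv119_chart44D hG hEq hC hAn hN
  refine decay510_of_tendsto (fun n z => pvolOf F fam ρ bV k v (K n) 0 1 z) (fun z => hLim 0 1 z) fun z => ?_
  filter_upwards [hρ 1 0 z] with n hn
  -- per colour, the (5.10) bound at this volume, on transverse legs
  have hcol : ∀ a : ι, |B12PolarizationTensor120.polComp ℝ (B12PolarizationTensor120.expChart (fam k v (K n)) ρ) bV (Fin.cast (F.P_d (K n)).symm 0)
      (siteOfInt F (K n) (k + 1) z) a (Fin.cast (F.P_d (K n)).symm 1) (siteOfInt F (K n) (k + 1) 0) a| ≤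
      16 * E₀ * C₉ ^ 2 * Real.exp (delta1 δ₀ κ Mg * Mg * c₁) * K₀ * K₁ * Real.exp (-(delta1 δ₀ κ Mg) * B12Sec2to5.l1 z) := by
    intro a
    rw [← hn]
    exact abs_polComp_diag_le_of_rows_transverseSymm F fam ρ bV k v Uc coords χ D act gradLeg E R K Gc ιe hE₀ hκ hC₉ hδ₀ hMg hK₀ hAn hB hLoc hRep hW hG
      hfl hC hcut n a (hdec n a) (hgeo n) (hcube n) (htree n) hL z
  -- average over the colours (verbatim from the trace road)
  rw [pvolOf_eq_trace]
  set Cz : ℝ := 16 * E₀ * C₉ ^ 2 * Real.exp (delta1 δ₀ κ Mg * Mg * c₁) * K₀ * K₁ * Real.exp (-(delta1 δ₀ κ Mg) * B12Sec2to5.l1 z) with hCz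
  have hsum : |∑ a : ι, B12PolarizationTensor120.polComp ℝ (B12PolarizationTensor120.expChart (fam k v (K n)) ρ) bV (Fin.cast (F.P_d (K n)).symm 0)
      (siteOfInt F (K n) (k + 1) z) a (Fin.cast (F.P_d (K n)).symm 1) (siteOfInt F (K n) (k + 1) 0) a| ≤ (Fintype.card ι : ℝ) * Cz :=
    (Finset.abs_sum_le_sum_abs _ _).trans <| by
      calc ∑ a : ι, |B12PolarizationTensor120.polComp ℝ (B12PolarizationTensor120.expChart (fam k v (K n)) ρ) bV (Fin.cast (F.P_d (K n)).symm 0)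
              (siteOfInt F (K n) (k + 1) z) a (Fin.cast (F.P_d (K n)).symm 1) (siteOfInt F (K n) (k + 1) 0) a|
          ≤ ∑ _a : ι, Cz := Finset.sum_le_sum fun a _ => hcol a
        _ = (Fintype.card ι : ℝ) * Cz := by rw [Finset.sum_const, Finset.card_univ, nsmul_eq_mul]
  rw [abs_mul, abs_inv, Nat.abs_cast]
  have hK₁ : 0 ≤ K₁ := (Finset.sum_nonneg fun c _ => (Real.exp_pos _).le).trans (hcube n (R.e n 1 0))
  have hCz0 : 0 ≤ Cz := by
    rw [hCz]
    exact mul_nonneg (mul_nonneg (mul_nonneg (mul_nonneg (mul_nonneg (mul_nonneg (by norm_num) hE₀) (sq_nonneg _)) (Real.exp_pos _).le) hK₀) hK₁)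
      (Real.exp_pos _).le
  rcases Nat.eq_zero_or_pos (Fintype.card ι) with h0 | hpos
  · rw [h0, Nat.cast_zero, inv_zero, zero_mul]; exact hCz0
  · have hcard : (0 : ℝ) < Fintype.card ι := Nat.cast_pos.2 hpos
    calc (Fintype.card ι : ℝ)⁻¹ * |∑ a : ι, _| ≤ (Fintype.card ι : ℝ)⁻¹ * ((Fintype.card ι : ℝ) * Cz) :=
          mul_le_mul_of_nonneg_left hsum (inv_nonneg.2 hcard.le)
      _ = Cz := by field_simp

/-- **COMPATIBILITY (no junk inhabitant)**: the tree's trace road is the special case of the transverse trace road with zero pure-gauge legs, the trivial flow and `T := 1`.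
[cite: Balaban1987RG1, (5.10) p.293, (1.10) p.262 (u = 1)] -/
theorem decay510_plimOf_of_rows_trace_of_transverseSymm [DecidableEq ι] (Uc : (n : ℕ) → (S n).Dom → Set (Fin (M n) → ℂ))
    (coords : (n : ℕ) → (S n).Dom → Finset (Fin (M n)))
    (χ : (n : ℕ) → (S n).Dom → (Fin (m n) → ℂ) → (Fin (M n) → ℂ)) (D : (n : ℕ) → (S n).Dom → Set (Fin (m n) → ℂ))
    {Gg : ℕ → Type*} (act : (n : ℕ) → Gg n → (Fin (M n) → ℂ) → (Fin (M n) → ℂ)) {Hg : ℕ → Type*} (toG : (n : ℕ) → Hg n → Gg n)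
    (A : (n : ℕ) → Hg n → ((Fin (m n) → ℂ) →L[ℂ] (Fin (m n) → ℂ))) (e : (n : ℕ) → Gg n) (he : ∀ n u, act n (e n) u = u)
    (R : Response9Data S M m 4) (K : ℕ → ℕ) (Gc : (n : ℕ) → ι → R.Λ n → (Fin (m n) → ℂ))
    (ιe : (n : ℕ) → (Fin (F.P (K n)).d → Site (F.P (K n)) (k + 1) → V) → (Fin (m n) → ℂ))
    {E₀ κ C₉ δ₀ Mg c₁ K₀ K₁ : ℝ} (hE₀ : 0 ≤ E₀) (hκ : 0 ≤ κ) (hC₉ : 0 ≤ C₉) (hδ₀ : 0 ≤ δ₀) (hMg : 0 < Mg) (hK₀ : 0 ≤ K₀)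
    (hA : FormatPlusG S M act Uc coords m χ (fun n => ΦfOf F fam ρ k v (K n)) ιe R.wrap R.emb R.πc E₀ κ)
    (hC : Chart44D S M Uc m χ D) (hEq : ChartEquivariant toG act χ A) (hN : ∀ n, NoInvariantCovector (A n))
    (hcut : ∀ n X u, ∀ i ∈ coords n X, χ n X (cutTo (R.cX n X) u) i = χ n X u i)
    (hdec : ∀ n (a : ι) X y, gauge (D n X) (cutTo (R.cX n X) (Gc n a y)) ≤ C₉ * Real.exp (-δ₀ * (R.G n).distD y X))
    (hgeo : ∀ n, GeomLeaf (R.G n) (R.ρ n) Mg c₁) (hcube : ∀ n, CubeSumLeaf (R.G n) (δ₀ / 2) K₁) (htree : ∀ n, TreeLeaf (R.Cc n) (κ / 2) K₀)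
    (hρ : ∀ (μ ν : Fin 4) (z : Fin 4 → ℤ), ∀ᶠ n in atTop, R.ρ n (R.e n μ 0) (R.e n ν z) = B12Sec2to5.l1 z)
    (hL : ∀ n, ιe n 0 = 0 ∧ ContDiffAt ℝ 2 (ιe n) 0 ∧ ∀ (a : ι) (μ : Fin 4) (z : Fin 4 → ℤ),
      Gc n a (R.e n μ z) = fderiv ℝ (ιe n) 0 (Pi.single (Fin.cast (F.P_d (K n)).symm μ) (Pi.single (siteOfInt F (K n) (k + 1) z) (bV a))))
    (hLim : Limit121 (fun n => pvolOf F fam ρ bV k v (K n)) (plimOf F fam ρ bV k v)) :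
    B12Sec2to5.Decay510 (plimOf F fam ρ bV k v 0 1) (16 * E₀ * C₉ ^ 2 * Real.exp (delta1 δ₀ κ Mg * Mg * c₁) * K₀ * K₁) (delta1 δ₀ κ Mg) :=
  decay510_plimOf_of_rows_trace_transverseSymm F fam ρ bV k v Uc coords χ D act toG A (fun n (_ : Unit) => (0 : Fin (m n) → ℂ)) R K Gc ιe
    hE₀ hκ hC₉ hδ₀ hMg hK₀ hA hC hEq hN (chartGaugeFlow_trivial act coords χ e he) hcut hdec hgeo hcube htree hρ
    (fun n => ⟨(hL n).1, (hL n).2.1, fun a => ⟨1, chartSymm_one (act := act) (χ := χ) n (e n) (he n), fun μ z => ⟨(), by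
      rw [← (hL n).2.2 a μ z]; simp⟩⟩⟩) hLim

end Road

end Summit.QuantumFields.YangMills.Theorems.K0AxTransverseWard

end
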